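import Mathlib

/-!
# The image algebra of a completely reducible finite-dimensional representation is semisimple

Route `MatrixMultiplication/GLnSeparatingDesigns`, crux `stmt-MatrixMultiplication-18361`
(`SeparationDegreeCost`), line `SketchIdeator1`; registered stub
`stub_isSemisimpleRing_range_asAlgebraHom`.

For a group `G` and a finite-dimensional complex representation `ρ : G → GL(V)` with linear
extension `ρ : ℂ[G] → End_ℂ V` (`Representation.asAlgebraHom ρ`), let
`A := ρ(ℂ[G]) = (Representation.asAlgebraHom ρ).range ⊆ End_ℂ V` be the image algebra. If `ρ` is
completely reducible (`ρ.IsSemisimpleRepresentation`: the lattice of subrepresentations is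
complemented), then `A` is a semisimple ring. This is the standard fact "a finite-dimensional
algebra with a faithful semisimple module is semisimple" (e.g. Lam, *A First Course in
Noncommutative Rings*, GTM 131, §2–§3; Bourbaki, *Algèbre* VIII), proved here in two steps:

* `V` is an `A`-module through `A ⊆ End_ℂ V`, and the identity `ρ.asModule → V` is a bijective
  semilinear map over the surjection `ℂ[G] ↠ A`; since `ρ.asModule` is a semisimple `ℂ[G]`-module
  (`Representation.isSemisimpleRepresentation_iff_isSemisimpleModule_asModule`), `V` is a
  semisimple `A`-module (`LinearMap.isSemisimpleModule_iff_of_bijective`).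
* For a basis `(bⱼ)_{j < m}` of `V`, `a ↦ (a bⱼ)ⱼ` is an injective (`Basis.ext`) `A`-linear map
  `A → V^m` into a semisimple `A`-module, so `A` is a semisimple left `A`-module
  (`IsSemisimpleModule.of_injective`), i.e. `IsSemisimpleRing A`
  (`isSemisimpleRing_subalgebra_end_of_isSemisimpleModule`).
-/

-- `Summit.MatrixMultiplication.MatrixMultiplication.…` is the tree's mandated summit-side namespace (Sub = Summit), flagged by `dupNamespace`.
set_option linter.dupNamespace false

namespace Summit.MatrixMultiplication.MatrixMultiplication.Theorems

/-- **An algebra of endomorphisms of a finite-dimensional space whose natural module is semisimple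
is a semisimple ring.** For a subalgebra `A ⊆ End_k V` (`k` a field, `V` finite-dimensional) with
`V` a semisimple `A`-module, `A` is a semisimple ring: for a basis `(bⱼ)_{j<m}` of `V` the map
`a ↦ (a bⱼ)ⱼ : A → V^m` is `A`-linear and injective (an endomorphism vanishing on a basis is zero),
and submodules of semisimple modules are semisimple. [folklore] -/
theorem isSemisimpleRing_subalgebra_end_of_isSemisimpleModule {k V : Type*} [Field k]
    [AddCommGroup V] [Module k V] [FiniteDimensional k V] (A : Subalgebra k (Module.End k V))
    [IsSemisimpleModule A V] : IsSemisimpleRing A := by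
  let b := Module.finBasis k V
  let Φ : A →ₗ[A] (Fin (Module.finrank k V) → V) :=
    { toFun := fun a j => (a : Module.End k V) (b j)
      map_add' := fun _ _ => rfl
      map_smul' := fun _ _ => rfl }
  refine IsSemisimpleModule.of_injective Φ fun a a' h => Subtype.ext (b.ext fun j => ?_)
  exact congr_fun h j

/-- **Registered stub `stub_isSemisimpleRing_range_asAlgebraHom` — the image algebra of a
completely reducible finite-dimensional complex representation is semisimple.** For a group `G`,
a finite-dimensional complex representation `ρ` of `G` on `V` all of whose subrepresentations have
complements, the image `ρ(ℂ[G]) = (Representation.asAlgebraHom ρ).range ⊆ End_ℂ V` is a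
semisimple ring: `V` is a semisimple module over it (its submodules are the subrepresentations:
the identity `ρ.asModule → V` is a bijective semilinear map over `ℂ[G] ↠ ρ(ℂ[G])`), and it embeds
`ρ(ℂ[G])`-linearly into `V^{dim V}` (`isSemisimpleRing_subalgebra_end_of_isSemisimpleModule`).
[folklore] -/
theorem stub_isSemisimpleRing_range_asAlgebraHom {G V : Type*} [Group G] [AddCommGroup V]
    [Module ℂ V] [FiniteDimensional ℂ V] (ρ : Representation ℂ G V)
    (hρ : ρ.IsSemisimpleRepresentation) :
    IsSemisimpleRing (Representation.asAlgebraHom ρ).range := by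
  let σ : MonoidAlgebra ℂ G →+* (Representation.asAlgebraHom ρ).range :=
    (Representation.asAlgebraHom ρ).rangeRestrict.toRingHom
  haveI : RingHomSurjective σ := ⟨AlgHom.rangeRestrict_surjective _⟩
  let e : ρ.asModule →ₛₗ[σ] V := { AddMonoidHom.id V with map_smul' := fun _ _ => rfl }
  haveI : IsSemisimpleModule (Representation.asAlgebraHom ρ).range V :=
    (e.isSemisimpleModule_iff_of_bijective Function.bijective_id).mp
      ((Representation.isSemisimpleRepresentation_iff_isSemisimpleModule_asModule ρ).mp hρ)
  exact isSemisimpleRing_subalgebra_end_of_isSemisimpleModule _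

end Summit.MatrixMultiplication.MatrixMultiplication.Theorems
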